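/-
Copyright (c) 2026 the pub-hodgecm-mathlib formalisation cell (harness21).  Prover seat hodgecm-mathlib-F0P3a-p07 (g12), 2026-09-01.  Road «S3-tree» (architect A-p16 (g30), A-102 (1)),
brick T3′ «depth-zero κ-transfer» (population (P-3) LEVI, L-γ holder F0P3a-p01 (g15)), organ (δ) L-δ «LINE STRATA + LEVI H-VALUES», FILE 2 of 2 (the H-values).
-/
import Literature.NumberTheory.Automorphic.LineStrataMeasure                         -- ★ FILE 1 (this seat): line algebra at `w`, `measureReal_lineStratum_zero ∕ _one`
import Literature.NumberTheory.Automorphic.UnitaryGroupTorusOrbitalIntegralCanonicalH   -- ★ B-p18 (g32): H-descent `classOrbitalIntegral_prod_eq_smul_integral_prod_of_torus_regular_of_nonsplit` (frame of §4)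
import Literature.NumberTheory.Rogawski1990.DepthZeroTransferHValuesTypeOne            -- ★ p846285 END FILE B: `indicator_ite_redMat_conj`, `isLocSmooth_indicator_ite_redMat`
import HarnessLib

/-!
# T3′'s H-side values near the identity, LEVI population (P-3):
# `Φ_H(⟦(t, u)⟧, χ₀) = ν_H(K_H)·J_H(t)·q⁻¹` and `Φ_H(⟦(t, u)⟧, χ₁) = ν_H(K_H)·J_H(t)·q⁻¹(q − 1)` for a deep regular diagonal `t`

Topic `NumberTheory/Rogawski1990`; namespace `Literature.NumberTheory.Automorphic.UnitaryGroup` (as ★ FILE B∕D of T6).  THEOREMS ONLY (no definition, no instance, no notation,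
no named fact, no `sorry`).  Cell `pub/hodgecm-mathlib`, crux H413 = `stmt-HodgeConjecture-24833`, road «S3-tree» (architect A-p16 (g30), A-102 (1)), brick T3′ «DEPTH-ZERO κ-TRANSFER»
HEAD v4 clause `stub_T3prime_levi` (population P-3 «LEVI»; L-γ assembly holder F0P3a-p01 (g15) consumes this file BY NAME), organ **(δ) L-δ «LINE STRATA + LEVI H-VALUES»,
FILE 2 (the H-values)** (seat F0P3a-p07 (g12)).  HONEST LABEL: HC_CM is proved only modulo the cell's 2 remaining named inputs (hLiu418 24832, h413 24833) until rung 0 closes;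
this file is unconditional and discharges nothing by itself.

THE MATHEMATICS ([Rogawski1990] §4.9 p. 55, Prop. 4.9.1 (b): the `H = U(2) × U(1)` side of the Levi case; §4.3 (4.3.1) p. 43).  `L` CM, `v` a finite place of `L⁺` NON-SPLIT and
UNRAMIFIED in `L` (`w ∣ v`, `c • w = w`, `q = N𝔭_v`), `H_v = U(Φ₂)(L⁺_v) × U(Φ₁)(L⁺_v)`, `K_H = K₂ × K₁` hyperspecial, `N₂` the line unipotent radical (★ FILE 1).  For
`t = diag(d₀, d₁) ∈ T₂(L⁺_v)` REGULAR (`d₀⁻¹d₁ − 1` a unit) and DEEP (`dᵢ ≡ 1 (mod 𝔪_w)`, so `t ∈ K₂` and `red(t_w) = 1`), `u ∈ U(Φ₁)(L⁺_v) = K₁`, and HEAD v4's class functions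
`χ_s = 1_{K_H}·[(red h_{W,w} − 1)² = 0 ∧ rank(red h_{W,w} − 1) = s]`: the ★ H-descent `Φ_H(⟦(t,u)⟧, φ) = ((ν_H(K_H) ∕ (κ₂(K₂)·μ(N₂ ∩ K₂)))·J_H(t)) · ∫_{K₂ × N₂} φ(k(tn)k⁻¹, u)`
is fed with `φ = χ_s`; `χ_s` is `K_H`-conjugation invariant (★ END `indicator_ite_redMat_conj`), `tn ∈ K₂ ⟺ n ∈ K₂`, `red((tn)_w) = red(t_w)·red(n_w) = red(n_w)`
(★ `redMat_mul_of_redMat_eq_one`), so the integrand is `1_{S_s}(n)` with `S_s` the rank-`s` line stratum, `∫ = κ₂(K₂)·μ(S_s)`, and ★ FILE 1 gives `μ(S_s) = q⁻¹·(1, q − 1)_s·μ(N₂ ∩ K₂)`: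
**`Φ_H(⟦(t,u)⟧, χ_s) = ν_H(K_H) · J_H(t) · q⁻¹ · (1, q − 1)_s`**, `J_H(t) = χ⁻(d₀⁻¹d₁ − 1)⁻¹` the ★ H-descent token (`= (√‖d₀⁻¹d₁ − 1‖)⁻¹`); `κ₂(K₂)`, `μ(N₂ ∩ K₂)` cancel.
* §1 `torus_mem_cmLocalIntegralLevel_of_deep`, `redMat_map_torus_eq_one_of_deep`, **`indicator_ite_redMat_conj_torus_mul_eq`** (the integrand collapse).
* §2 HEADS **`classOrbitalIntegral_chiZero_eq_of_torus_deep`**, **`classOrbitalIntegral_chiOne_eq_of_torus_deep`** — binders = ★ H-descent's (`νH` any right-invariant Haar,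
  general `P_H` + `hPH`, `t : ↥(cmBorelTriple L 2 v).M`, `d hd hb hreg₂ u hK₁`) + `hv` (unramified) + deepness `ht1` + ONE decidability binder `χdec` (any instance: pass `_`);
  no `κ₂ μN₂` (instantiated inside), no `v ∤ 2`.

## References
* [Rogawski1990] J. D. Rogawski, *Automorphic Representations of Unitary Groups in Three Variables*, Ann. of Math. Stud. 123 (1990), §1.10 p. 9; §4.3 (4.3.1) p. 43; §4.9 p. 54–55,
  Prop. 4.9.1 (b).
* [Flicker1998UnitaryFL] Y. Z. Flicker, *Elementary proof of the fundamental lemma for a unitary group*, Canad. J. Math. 50 (1998), §2.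
* [Kottwitz1986] R. E. Kottwitz, *Base change for unit elements of Hecke algebras*, Compositio Math. 60 (1986), §3.
* [GetzHahn2024] J. R. Getz, H. Hahn, *An Introduction to Automorphic Representations*, GTM 300 (2024), §3.5 (3.10).
-/

set_option autoImplicit false

noncomputable section

open MeasureTheory Measure Set Filter Topology NumberField IsDedekindDomain Matrix ValuativeRel
open scoped ENNReal NNReal ValuativeRel Matrix MatrixGroups

namespace Literature.NumberTheory.Automorphic.UnitaryGroup

open Literature.NumberTheory.Rogawski1990 Literature.NumberTheory.Automorphic Literature.NumberTheory.Automorphic.IntegralReduction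
open Literature.NumberTheory.Automorphic.UnitaryGroup.HeisRing Literature.NumberTheory.Automorphic.UnitaryGroup.LineRing

variable (L : Type) [Field L] [NumberField L] [IsCMField L] (v : HeightOneSpectrum (𝓞 ↥(maximalRealSubfield L)))
  (w : PlacesOver L v) (hw : IsCMField.complexConj L • w.1 = w.1)

/-! ## §1 Deep diagonal `t`: `t ∈ K₂`, `red(t_w) = 1`, and the collapse of the Iwasawa integrand `χ_s(k(tn)k⁻¹, u)` -/

include hw in
/-- **A DEEP diagonal `t = diag(d₀, d₁) ∈ T₂` lies in `K₂`** (`|dᵢ,w − 1| < 1 ⇒ |dᵢ,w| = |dᵢ⁻¹,w| = 1`, one place `w ∣ v`). [cite: Rogawski1990, §1.10 p. 9; §4.9 p. 54] -/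
theorem torus_mem_cmLocalIntegralLevel_of_deep (t : ↥(cmBorelTriple L 2 v).M) {d : Fin 2 → (LocalRing L v)ˣ}
    (hd : glDiagonal 2 (LocalRing L v) d = ((t : ↥(unitaryGroupOfForm (conjLocal L (IsCMField.complexConj L) v) (cmLocalForm L 2 v))) : GL (Fin 2) (LocalRing L v)))
    (ht1 : ∀ i : Fin 2, Valued.v ((((d i : (LocalRing L v)ˣ) : LocalRing L v) w) - 1) < 1) :
    (t : ↥(unitaryGroupOfForm (conjLocal L (IsCMField.complexConj L) v) (cmLocalForm L 2 v))) ∈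
      cmLocalIntegralLevel L 2 (Matrix.of fun i j : Fin 2 => if i.val + j.val + 1 = 2 then (1 : L) else 0) v := by
  haveI : Algebra.IsQuadraticExtension ↥(maximalRealSubfield L) L := IsCMField.isQuadraticExtension L
  haveI : Subsingleton (PlacesOver L v) :=
    PlacesOver.subsingleton_of_smul_eq (IsCMField.complexConj L) (IsCMField.complexConj_ne_one L) w hw
  -- `|dᵢ,w| = 1` and `|dᵢ⁻¹,w| = 1`
  have hd1 : ∀ i : Fin 2, Valued.v (((d i : (LocalRing L v)ˣ) : LocalRing L v) w) = 1 := fun i => by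
    have h := Valuation.map_eq_of_sub_lt (Valued.v : Valuation (w.1.adicCompletion L) _) (x := (1 : w.1.adicCompletion L))
      (y := ((d i : (LocalRing L v)ˣ) : LocalRing L v) w) (by rw [map_one]; exact ht1 i)
    rwa [map_one] at h
  have hdi1 : ∀ i : Fin 2, Valued.v ((((d i)⁻¹ : (LocalRing L v)ˣ) : LocalRing L v) w) = 1 := fun i => by
    have h := congrFun (Units.inv_mul (d i)) w
    rw [Pi.mul_apply, Pi.one_apply] at h
    have hv := congrArg (Valued.v : w.1.adicCompletion L → _) h
    rw [map_mul, map_one, hd1 i, mul_one] at hv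
    exact hv
  have hmat : ((t : ↥(unitaryGroupOfForm (conjLocal L (IsCMField.complexConj L) v) (cmLocalForm L 2 v))) : GL (Fin 2) (LocalRing L v)).val =
      Matrix.diagonal fun k => ((d k : (LocalRing L v)ˣ) : LocalRing L v) := by
    rw [← hd]; exact coe_glDiagonal 2 (LocalRing L v) d
  have hmat' : (((t : ↥(unitaryGroupOfForm (conjLocal L (IsCMField.complexConj L) v) (cmLocalForm L 2 v)))⁻¹ :
        ↥(unitaryGroupOfForm (conjLocal L (IsCMField.complexConj L) v) (cmLocalForm L 2 v))) : GL (Fin 2) (LocalRing L v)).val =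
      Matrix.diagonal fun k => (((d k)⁻¹ : (LocalRing L v)ˣ) : LocalRing L v) := by
    rw [Subgroup.coe_inv, ← hd, ← map_inv]
    exact coe_glDiagonal 2 (LocalRing L v) d⁻¹
  rw [mem_cmLocalIntegralLevel_iff_forall_v_le_one]
  refine ⟨fun i j w' => ?_, fun i j w' => ?_⟩ <;> obtain rfl : w' = w := Subsingleton.elim _ _
  · rw [hmat, Matrix.diagonal_apply]
    split_ifs with h
    · exact (hd1 i).le
    · rw [Pi.zero_apply, map_zero]; exact zero_le
  · rw [hmat', Matrix.diagonal_apply]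
    split_ifs with h
    · exact (hdi1 i).le
    · rw [Pi.zero_apply, map_zero]; exact zero_le

/-- **`red(t_w) = 1` for a DEEP diagonal `t`** (`red dᵢ,w = red 1 = 1` since `|dᵢ,w − 1| < 1`). [cite: Kottwitz1986, §3] [cite: Rogawski1990, §4.9 p. 54] -/
theorem redMat_map_torus_eq_one_of_deep (t : ↥(cmBorelTriple L 2 v).M) {d : Fin 2 → (LocalRing L v)ˣ}
    (hd : glDiagonal 2 (LocalRing L v) d = ((t : ↥(unitaryGroupOfForm (conjLocal L (IsCMField.complexConj L) v) (cmLocalForm L 2 v))) : GL (Fin 2) (LocalRing L v)))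
    (ht1 : ∀ i : Fin 2, Valued.v ((((d i : (LocalRing L v)ˣ) : LocalRing L v) w) - 1) < 1) :
    redMat ((((t : ↥(unitaryGroupOfForm (conjLocal L (IsCMField.complexConj L) v) (cmLocalForm L 2 v))) : GL (Fin 2) (LocalRing L v)).val.map
        (Pi.evalRingHom (fun w' : PlacesOver L v => w'.1.adicCompletion L) w))) = 1 := by
  have hmat : ((t : ↥(unitaryGroupOfForm (conjLocal L (IsCMField.complexConj L) v) (cmLocalForm L 2 v))) : GL (Fin 2) (LocalRing L v)).val =
      Matrix.diagonal fun k => ((d k : (LocalRing L v)ˣ) : LocalRing L v) := by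
    rw [← hd]; exact coe_glDiagonal 2 (LocalRing L v) d
  -- `red dᵢ,w = red 1 = 1` since `|dᵢ,w − 1| < 1`
  have hred : ∀ i : Fin 2, red (((d i : (LocalRing L v)ˣ) : LocalRing L v) w) = 1 := fun i => by
    have h1 : Valued.v (((d i : (LocalRing L v)ˣ) : LocalRing L v) w) = 1 := by
      have h := Valuation.map_eq_of_sub_lt (Valued.v : Valuation (w.1.adicCompletion L) _) (x := (1 : w.1.adicCompletion L))
        (y := ((d i : (LocalRing L v)ˣ) : LocalRing L v) w) (by rw [map_one]; exact ht1 i)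
      rwa [map_one] at h
    have hO : ((d i : (LocalRing L v)ˣ) : LocalRing L v) w ∈ 𝒪[w.1.adicCompletion L] := (v_le_one_iff_mem_integer _).1 h1.le
    have h1O : (1 : w.1.adicCompletion L) ∈ 𝒪[w.1.adicCompletion L] := (v_le_one_iff_mem_integer _).1 (by rw [map_one])
    rw [red_eq_red_of_valuation_sub_lt_one hO h1O ((v_lt_one_iff_valuation_lt_one _).1 (ht1 i)), red_one]
  have h0 : red (0 : w.1.adicCompletion L) = 0 := by
    rw [show (0 : w.1.adicCompletion L) = ((0 : 𝒪[w.1.adicCompletion L]) : w.1.adicCompletion L) from rfl, red_coe, map_zero]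
  rw [hmat, Matrix.diagonal_map (map_zero _)]
  unfold redMat
  rw [Matrix.diagonal_map h0]
  ext i j
  rw [Matrix.diagonal_apply, Matrix.one_apply]
  split_ifs with h
  · exact hred i
  · rfl

set_option maxHeartbeats 1600000 in
include hw in
/-- **THE INTEGRAND COLLAPSE**: for `k ∈ K₂`, a DEEP diagonal `t ∈ T₂`, `n ∈ N₂`, `u ∈ U(Φ₁)(L⁺_v) = K₁`, and HEAD v4's `χ_s = 1_{K_H}·[(red h_{W,w} − 1)² = 0 ∧ rank = s]`:
`χ_s(k (t n) k⁻¹, u) = 1_{S_s}(n)`, `S_s = {n ∈ N₂ : n ∈ K₂ ∧ (red(n_w) − 1)² = 0 ∧ rank(red(n_w) − 1) = s}` — `χ_s` is `K_H`-conjugation invariant (★ END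
`indicator_ite_redMat_conj`), `tn ∈ K₂ ⟺ n ∈ K₂` (`t ∈ K₂`), and `red((tn)_w) = red(t_w)·red(n_w) = red(n_w)` (★ `redMat_mul_of_redMat_eq_one`).
[cite: Rogawski1990, §4.9 p. 54–55] [cite: Kottwitz1986, §3] -/
theorem indicator_ite_redMat_conj_torus_mul_eq (s : ℕ)
    (χdec : ∀ h : ((cmDatum L 2 (Matrix.of fun i j : Fin 2 => if i.val + j.val + 1 = 2 then (1 : L) else 0)).Local v × (cmDatum L 1 (Matrix.of fun i j : Fin 1 => if i.val + j.val + 1 = 1 then (1 : L) else 0)).Local v), Decidable ((redMat (((h).1.val : GL (Fin 2) (UnitaryGroup.LocalRing L v)).val.map (Pi.evalRingHom (fun w' : PlacesOver L v => w'.1.adicCompletion L) w)) - 1) ^ 2 = 0 ∧ (redMat (((h).1.val : GL (Fin 2) (UnitaryGroup.LocalRing L v)).val.map (Pi.evalRingHom (fun w' : PlacesOver L v => w'.1.adicCompletion L) w)) - 1).rank = s))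
    (hK₁ : ∀ x : (cmDatum L 1 (Matrix.of fun i j : Fin 1 => if i.val + j.val + 1 = 1 then (1 : L) else 0)).Local v, x ∈ cmLocalIntegralLevel L 1 (Matrix.of fun i j : Fin 1 => if i.val + j.val + 1 = 1 then (1 : L) else 0) v)
    {k : ↥(unitaryGroupOfForm (conjLocal L (IsCMField.complexConj L) v) (cmLocalForm L 2 v))} (hk : k ∈ cmLocalIntegralLevel L 2 (Matrix.of fun i j : Fin 2 => if i.val + j.val + 1 = 2 then (1 : L) else 0) v)
    (t : ↥(cmBorelTriple L 2 v).M) {d : Fin 2 → (LocalRing L v)ˣ}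
    (hd : glDiagonal 2 (LocalRing L v) d = ((t : ↥(unitaryGroupOfForm (conjLocal L (IsCMField.complexConj L) v) (cmLocalForm L 2 v))) : GL (Fin 2) (LocalRing L v)))
    (ht1 : ∀ i : Fin 2, Valued.v ((((d i : (LocalRing L v)ˣ) : LocalRing L v) w) - 1) < 1)
    (n : ↥(cmBorelTriple L 2 v).N) (u : (cmDatum L 1 (Matrix.of fun i j : Fin 1 => if i.val + j.val + 1 = 1 then (1 : L) else 0)).Local v) :
    (((((cmLocalIntegralLevel L 2 (Matrix.of fun i j : Fin 2 => if i.val + j.val + 1 = 2 then (1 : L) else 0) v).prod (cmLocalIntegralLevel L 1 (Matrix.of fun i j : Fin 1 => if i.val + j.val + 1 = 1 then (1 : L) else 0) v)) : Subgroup ((cmDatum L 2 (Matrix.of fun i j : Fin 2 => if i.val + j.val + 1 = 2 then (1 : L) else 0)).Local v × (cmDatum L 1 (Matrix.of fun i j : Fin 1 => if i.val + j.val + 1 = 1 then (1 : L) else 0)).Local v)) : Set ((cmDatum L 2 (Matrix.of fun i j : Fin 2 => if i.val + j.val + 1 = 2 then (1 : L) else 0)).Local v × (cmDatum L 1 (Matrix.of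 fun i j : Fin 1 => if i.val + j.val + 1 = 1 then (1 : L) else 0)).Local v)).indicator fun h => if (redMat (((h).1.val : GL (Fin 2) (UnitaryGroup.LocalRing L v)).val.map (Pi.evalRingHom (fun w' : PlacesOver L v => w'.1.adicCompletion L) w)) - 1) ^ 2 = 0 ∧ (redMat (((h).1.val : GL (Fin 2) (UnitaryGroup.LocalRing L v)).val.map (Pi.evalRingHom (fun w' : PlacesOver L v => w'.1.adicCompletion L) w)) - 1).rank = s then (1 : ℂ) else 0)
        (((k * ((t : ↥(unitaryGroupOfForm (conjLocal L (IsCMField.complexConj L) v) (cmLocalForm L 2 v))) * (n : ↥(unitaryGroupOfForm (conjLocal L (IsCMField.complexConj L) v) (cmLocalForm L 2 v)))) * k⁻¹ : ↥(unitaryGroupOfForm (conjLocal L (IsCMField.complexConj L) v) (cmLocalForm L 2 v))) : (cmDatum L 2 (Matrix.of fun i j : Fin 2 => if i.val + j.val + 1 = 2 then (1 : L) else 0)).Local v), u) =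
      {n : ↥(cmBorelTriple L 2 v).N | (n : ↥(unitaryGroupOfForm (conjLocal L (IsCMField.complexConj L) v) (cmLocalForm L 2 v))) ∈
          cmLocalIntegralLevel L 2 (Matrix.of fun i j : Fin 2 => if i.val + j.val + 1 = 2 then (1 : L) else 0) v ∧
        ((redMat ((((n : ↥(unitaryGroupOfForm (conjLocal L (IsCMField.complexConj L) v) (cmLocalForm L 2 v))) : GL (Fin 2) (LocalRing L v)).val.map
            (Pi.evalRingHom (fun w' : PlacesOver L v => w'.1.adicCompletion L) w))) - 1) ^ 2 = 0 ∧
          (redMat ((((n : ↥(unitaryGroupOfForm (conjLocal L (IsCMField.complexConj L) v) (cmLocalForm L 2 v))) : GL (Fin 2) (LocalRing L v)).val.map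
            (Pi.evalRingHom (fun w' : PlacesOver L v => w'.1.adicCompletion L) w))) - 1).rank = s)}.indicator (fun _ => (1 : ℂ)) n := by
  haveI : Algebra.IsQuadraticExtension ↥(maximalRealSubfield L) L := IsCMField.isQuadraticExtension L
  haveI : Subsingleton (PlacesOver L v) :=
    PlacesOver.subsingleton_of_smul_eq (IsCMField.complexConj L) (IsCMField.complexConj_ne_one L) w hw
  have htK := torus_mem_cmLocalIntegralLevel_of_deep L v w hw t hd ht1
  have htred := redMat_map_torus_eq_one_of_deep L v w t hd ht1
  -- Step 1: the point `(k(tn)k⁻¹, u)` is the `K_H`-conjugate of `(tn, u)` by `(k, 1) ∈ K_H`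
  set x : ↥(unitaryGroupOfForm (conjLocal L (IsCMField.complexConj L) v) (cmLocalForm L 2 v)) := (t : ↥(unitaryGroupOfForm (conjLocal L (IsCMField.complexConj L) v) (cmLocalForm L 2 v))) * (n : ↥(unitaryGroupOfForm (conjLocal L (IsCMField.complexConj L) v) (cmLocalForm L 2 v))) with hxdef
  have hconj : ((((k * x * k⁻¹ : ↥(unitaryGroupOfForm (conjLocal L (IsCMField.complexConj L) v) (cmLocalForm L 2 v))) : ((cmDatum L 2 (Matrix.of fun i j : Fin 2 => if i.val + j.val + 1 = 2 then (1 : L) else 0)).Local v)), u) : ((cmDatum L 2 (Matrix.of fun i j : Fin 2 => if i.val + j.val + 1 = 2 then (1 : L) else 0)).Local v) × ((cmDatum L 1 (Matrix.of fun i j : Fin 1 => if i.val + j.val + 1 = 1 then (1 : L) else 0)).Local v)) =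
      ((((k : ↥(unitaryGroupOfForm (conjLocal L (IsCMField.complexConj L) v) (cmLocalForm L 2 v))) : ((cmDatum L 2 (Matrix.of fun i j : Fin 2 => if i.val + j.val + 1 = 2 then (1 : L) else 0)).Local v)), (1 : ((cmDatum L 1 (Matrix.of fun i j : Fin 1 => if i.val + j.val + 1 = 1 then (1 : L) else 0)).Local v))) : ((cmDatum L 2 (Matrix.of fun i j : Fin 2 => if i.val + j.val + 1 = 2 then (1 : L) else 0)).Local v) × ((cmDatum L 1 (Matrix.of fun i j : Fin 1 => if i.val + j.val + 1 = 1 then (1 : L) else 0)).Local v)) * ((((x : ↥(unitaryGroupOfForm (conjLocal L (IsCMField.complexConj L) v) (cmLocalForm L 2 v))) : ((cmDatum L 2 (Matrix.of fun i j : Fin 2 => if i.val + j.val + 1 = 2 then (1 : L) else 0)).Local v)), u) : ((cmDatum L 2 (Matrix.of fun i j : Fin 2 => if i.val + j.val + 1 = 2 then (1 : L) else 0)).Local v) × ((cmDatum L 1 (Matrix.of fun i j : Fin 1 => if i.val + j.val + 1 = 1 then (1 : L) else 0)).Local v)) * ((((k : ↥(unitaryGroupOfForm (conjLocal L (IsCMField.complexConj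 L) v) (cmLocalForm L 2 v))) : ((cmDatum L 2 (Matrix.of fun i j : Fin 2 => if i.val + j.val + 1 = 2 then (1 : L) else 0)).Local v)), (1 : ((cmDatum L 1 (Matrix.of fun i j : Fin 1 => if i.val + j.val + 1 = 1 then (1 : L) else 0)).Local v))) : ((cmDatum L 2 (Matrix.of fun i j : Fin 2 => if i.val + j.val + 1 = 2 then (1 : L) else 0)).Local v) × ((cmDatum L 1 (Matrix.of fun i j : Fin 1 => if i.val + j.val + 1 = 1 then (1 : L) else 0)).Local v))⁻¹ := by
    refine Prod.ext ?_ ?_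
    · rfl
    · change u = 1 * u * 1⁻¹
      rw [inv_one, mul_one, one_mul]
  have hkKH : ((((k : ↥(unitaryGroupOfForm (conjLocal L (IsCMField.complexConj L) v) (cmLocalForm L 2 v))) : ((cmDatum L 2 (Matrix.of fun i j : Fin 2 => if i.val + j.val + 1 = 2 then (1 : L) else 0)).Local v)), (1 : ((cmDatum L 1 (Matrix.of fun i j : Fin 1 => if i.val + j.val + 1 = 1 then (1 : L) else 0)).Local v))) : ((cmDatum L 2 (Matrix.of fun i j : Fin 2 => if i.val + j.val + 1 = 2 then (1 : L) else 0)).Local v) × ((cmDatum L 1 (Matrix.of fun i j : Fin 1 => if i.val + j.val + 1 = 1 then (1 : L) else 0)).Local v)) ∈ (((cmLocalIntegralLevel L 2 (Matrix.of fun i j : Fin 2 => if i.val + j.val + 1 = 2 then (1 : L) else 0) v).prod (cmLocalIntegralLevel L 1 (Matrix.of fun i j : Fin 1 => if i.val + j.val + 1 = 1 then (1 : L) else 0) v)) : Subgroup (((cmDatum L 2 (Matrix.of fun i j : Fin 2 => if i.val + j.val + 1 = 2 then (1 : L) else 0)).Local v) × ((cmDatum L 1 (Matrix.of fun i j : Fin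 1 => if i.val + j.val + 1 = 1 then (1 : L) else 0)).Local v))) :=
    Subgroup.mem_prod.2 ⟨hk, one_mem _⟩
  rw [hconj, indicator_ite_redMat_conj L v w hw s χdec _ hkKH]
  -- Step 2: membership `(tn, u) ∈ K_H ⟺ n ∈ K₂`
  have hmemH : (((((x : ↥(unitaryGroupOfForm (conjLocal L (IsCMField.complexConj L) v) (cmLocalForm L 2 v))) : ((cmDatum L 2 (Matrix.of fun i j : Fin 2 => if i.val + j.val + 1 = 2 then (1 : L) else 0)).Local v)), u) : ((cmDatum L 2 (Matrix.of fun i j : Fin 2 => if i.val + j.val + 1 = 2 then (1 : L) else 0)).Local v) × ((cmDatum L 1 (Matrix.of fun i j : Fin 1 => if i.val + j.val + 1 = 1 then (1 : L) else 0)).Local v)) ∈ ((((cmLocalIntegralLevel L 2 (Matrix.of fun i j : Fin 2 => if i.val + j.val + 1 = 2 then (1 : L) else 0) v).prod (cmLocalIntegralLevel L 1 (Matrix.of fun i j : Fin 1 => if i.val + j.val + 1 = 1 then (1 : L) else 0) v)) : Subgroup (((cmDatum L 2 (Matrix.of fun i j : Fin 2 => if i.val + j.val + 1 = 2 then (1 :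 L) else 0)).Local v) × ((cmDatum L 1 (Matrix.of fun i j : Fin 1 => if i.val + j.val + 1 = 1 then (1 : L) else 0)).Local v))) : Set (((cmDatum L 2 (Matrix.of fun i j : Fin 2 => if i.val + j.val + 1 = 2 then (1 : L) else 0)).Local v) × ((cmDatum L 1 (Matrix.of fun i j : Fin 1 => if i.val + j.val + 1 = 1 then (1 : L) else 0)).Local v)))) ↔
      (n : ↥(unitaryGroupOfForm (conjLocal L (IsCMField.complexConj L) v) (cmLocalForm L 2 v))) ∈ cmLocalIntegralLevel L 2 (Matrix.of fun i j : Fin 2 => if i.val + j.val + 1 = 2 then (1 : L) else 0) v := by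
    rw [SetLike.mem_coe, Subgroup.mem_prod]
    constructor
    · rintro ⟨h1, -⟩
      exact (Subgroup.mul_mem_cancel_left (cmLocalIntegralLevel L 2 (Matrix.of fun i j : Fin 2 => if i.val + j.val + 1 = 2 then (1 : L) else 0) v) htK).1 h1
    · intro h
      exact ⟨(Subgroup.mul_mem_cancel_left (cmLocalIntegralLevel L 2 (Matrix.of fun i j : Fin 2 => if i.val + j.val + 1 = 2 then (1 : L) else 0) v) htK).2 h, hK₁ u⟩
  by_cases hn : (n : ↥(unitaryGroupOfForm (conjLocal L (IsCMField.complexConj L) v) (cmLocalForm L 2 v))) ∈ cmLocalIntegralLevel L 2 (Matrix.of fun i j : Fin 2 => if i.val + j.val + 1 = 2 then (1 : L) else 0) v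
  · -- Step 3: `red((tn)_w) = red(n_w)` on `K₂`
    have hyn := (unipotent_mem_cmLocalIntegralLevel_iff L v w hw n).1 hn
    have hVt : ValBound 1 ((((t : ↥(unitaryGroupOfForm (conjLocal L (IsCMField.complexConj L) v) (cmLocalForm L 2 v))) : GL (Fin 2) (LocalRing L v)).val.map (Pi.evalRingHom (fun w' : PlacesOver L v => w'.1.adicCompletion L) w))) := by
      intro i j
      rw [← v_le_one_iff_valuation_le_one]
      exact v_apply_le_one_of_mem_cmLocalIntegralLevel L 2 v _ htK i j w
    have hVn : ValBound 1 ((((n : ↥(unitaryGroupOfForm (conjLocal L (IsCMField.complexConj L) v) (cmLocalForm L 2 v))) : GL (Fin 2) (LocalRing L v)).val.map (Pi.evalRingHom (fun w' : PlacesOver L v => w'.1.adicCompletion L) w))) := by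
      intro i j
      rw [← v_le_one_iff_valuation_le_one]
      exact v_apply_le_one_of_mem_cmLocalIntegralLevel L 2 v _ hn i j w
    have hred : redMat ((((((((x : ↥(unitaryGroupOfForm (conjLocal L (IsCMField.complexConj L) v) (cmLocalForm L 2 v))) : ((cmDatum L 2 (Matrix.of fun i j : Fin 2 => if i.val + j.val + 1 = 2 then (1 : L) else 0)).Local v)), u) : ((cmDatum L 2 (Matrix.of fun i j : Fin 2 => if i.val + j.val + 1 = 2 then (1 : L) else 0)).Local v) × ((cmDatum L 1 (Matrix.of fun i j : Fin 1 => if i.val + j.val + 1 = 1 then (1 : L) else 0)).Local v)).1).val : GL (Fin 2) (UnitaryGroup.LocalRing L v)).val.map (Pi.evalRingHom (fun w' : PlacesOver L v => w'.1.adicCompletion L) w))) =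
        redMat ((((n : ↥(unitaryGroupOfForm (conjLocal L (IsCMField.complexConj L) v) (cmLocalForm L 2 v))) : GL (Fin 2) (LocalRing L v)).val.map (Pi.evalRingHom (fun w' : PlacesOver L v => w'.1.adicCompletion L) w))) := by
      have hval : ((((((x : ↥(unitaryGroupOfForm (conjLocal L (IsCMField.complexConj L) v) (cmLocalForm L 2 v))) : ((cmDatum L 2 (Matrix.of fun i j : Fin 2 => if i.val + j.val + 1 = 2 then (1 : L) else 0)).Local v)), u) : ((cmDatum L 2 (Matrix.of fun i j : Fin 2 => if i.val + j.val + 1 = 2 then (1 : L) else 0)).Local v) × ((cmDatum L 1 (Matrix.of fun i j : Fin 1 => if i.val + j.val + 1 = 1 then (1 : L) else 0)).Local v)).1).val : GL (Fin 2) (UnitaryGroup.LocalRing L v)).val =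
          ((t : ↥(unitaryGroupOfForm (conjLocal L (IsCMField.complexConj L) v) (cmLocalForm L 2 v))) : GL (Fin 2) (LocalRing L v)).val * ((n : ↥(unitaryGroupOfForm (conjLocal L (IsCMField.complexConj L) v) (cmLocalForm L 2 v))) : GL (Fin 2) (LocalRing L v)).val := rfl
      rw [hval, Matrix.map_mul, redMat_mul_of_redMat_eq_one hVt hVn htred]
    have hmem : ((((x : ↥(unitaryGroupOfForm (conjLocal L (IsCMField.complexConj L) v) (cmLocalForm L 2 v))) : ((cmDatum L 2 (Matrix.of fun i j : Fin 2 => if i.val + j.val + 1 = 2 then (1 : L) else 0)).Local v)), u) : ((cmDatum L 2 (Matrix.of fun i j : Fin 2 => if i.val + j.val + 1 = 2 then (1 : L) else 0)).Local v) × ((cmDatum L 1 (Matrix.of fun i j : Fin 1 => if i.val + j.val + 1 = 1 then (1 : L) else 0)).Local v)) ∈ ((((cmLocalIntegralLevel L 2 (Matrix.of fun i j : Fin 2 => if i.val + j.val + 1 = 2 then (1 : L) else 0) v).prod (cmLocalIntegralLevel L 1 (Matrix.of fun i j : Fin 1 => if i.val + j.val + 1 = 1 then (1 : L) else 0) v))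 : Subgroup (((cmDatum L 2 (Matrix.of fun i j : Fin 2 => if i.val + j.val + 1 = 2 then (1 : L) else 0)).Local v) × ((cmDatum L 1 (Matrix.of fun i j : Fin 1 => if i.val + j.val + 1 = 1 then (1 : L) else 0)).Local v))) : Set (((cmDatum L 2 (Matrix.of fun i j : Fin 2 => if i.val + j.val + 1 = 2 then (1 : L) else 0)).Local v) × ((cmDatum L 1 (Matrix.of fun i j : Fin 1 => if i.val + j.val + 1 = 1 then (1 : L) else 0)).Local v))) := hmemH.2 hn
    rw [Set.indicator_of_mem hmem]
    by_cases hc : (redMat ((((n : ↥(unitaryGroupOfForm (conjLocal L (IsCMField.complexConj L) v) (cmLocalForm L 2 v))) : GL (Fin 2) (LocalRing L v)).val.map (Pi.evalRingHom (fun w' : PlacesOver L v => w'.1.adicCompletion L) w))) - 1) ^ 2 = 0 ∧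
        (redMat ((((n : ↥(unitaryGroupOfForm (conjLocal L (IsCMField.complexConj L) v) (cmLocalForm L 2 v))) : GL (Fin 2) (LocalRing L v)).val.map (Pi.evalRingHom (fun w' : PlacesOver L v => w'.1.adicCompletion L) w))) - 1).rank = s
    · have hc' := hc
      rw [← hred] at hc'
      rw [if_pos hc']
      classical
      simp only [Set.indicator_apply, Set.mem_setOf_eq]
      rw [if_pos (And.intro hn hc)]
    · have hc' := hc
      rw [← hred] at hc'
      rw [if_neg hc']
      classical
      simp only [Set.indicator_apply, Set.mem_setOf_eq]
      rw [if_neg (fun h : _ ∧ _ => hc h.2)]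
  · have hmem : ((((x : ↥(unitaryGroupOfForm (conjLocal L (IsCMField.complexConj L) v) (cmLocalForm L 2 v))) : ((cmDatum L 2 (Matrix.of fun i j : Fin 2 => if i.val + j.val + 1 = 2 then (1 : L) else 0)).Local v)), u) : ((cmDatum L 2 (Matrix.of fun i j : Fin 2 => if i.val + j.val + 1 = 2 then (1 : L) else 0)).Local v) × ((cmDatum L 1 (Matrix.of fun i j : Fin 1 => if i.val + j.val + 1 = 1 then (1 : L) else 0)).Local v)) ∉ ((((cmLocalIntegralLevel L 2 (Matrix.of fun i j : Fin 2 => if i.val + j.val + 1 = 2 then (1 : L) else 0) v).prod (cmLocalIntegralLevel L 1 (Matrix.of fun i j : Fin 1 => if i.val + j.val + 1 = 1 then (1 : L) else 0) v)) : Subgroup (((cmDatum L 2 (Matrix.of fun i j : Fin 2 => if i.val + j.val + 1 = 2 then (1 : L) else 0)).Local v) × ((cmDatum L 1 (Matrix.of fun i j : Fin 1 => if i.val + j.val + 1 = 1 then (1 : L) else 0)).Local v))) : Set (((cmDatum L 2 (Matrix.of fun i j : Fin 2 => if i.val + j.val + 1 = 2 then (1 : L) else 0)).Local v) × ((cmDatum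 L 1 (Matrix.of fun i j : Fin 1 => if i.val + j.val + 1 = 1 then (1 : L) else 0)).Local v))) := fun h => hn (hmemH.1 h)
    rw [Set.indicator_of_notMem hmem]
    classical
    simp only [Set.indicator_apply, Set.mem_setOf_eq]
    rw [if_neg (fun h : _ ∧ _ => hn h.1)]

/-! ## §2 HEADS: the canonical orbital integrals `Φ_H(⟦(t, u)⟧, χ₀)`, `Φ_H(⟦(t, u)⟧, χ₁)` at a deep regular diagonal class -/

set_option maxHeartbeats 3200000 in
set_option synthInstance.maxHeartbeats 400000 in
-- instance-term unification on the CM local carriers (two spellings of `U(Φ₂)(L⁺_v)`), as in ★ `UnitaryGroupTorusOrbitalIntegralCanonicalH`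
include hw in
/-- **L-δ HEAD (χ₀): `Φ_H(⟦(t, u)⟧, χ₀) = ν_H(K₂ × K₁) · J_H(t) · q⁻¹`** for HEAD v4's `χ₀ = 1_{K_H}·[(red h_{W,w} − 1)² = 0 ∧ rank(red h_{W,w} − 1) = 0]`, at the class of
`(t, u)`, `t = diag(d₀, d₁) ∈ T₂(L⁺_v)` REGULAR (`d₀⁻¹d₁ − 1` a unit) and DEEP (`dᵢ ≡ 1 (mod 𝔪_w)`), `u ∈ U(Φ₁)(L⁺_v) = K₁`; `m_H` CANONICAL for `(P_H, ν_H)` (`ν_H` ANY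
right-invariant Haar measure), `J_H(t) = χ⁻(d₀⁻¹d₁ − 1)⁻¹` the ★ H-descent token.  Proof: ★ H-descent `classOrbitalIntegral_prod_eq_smul_integral_prod_of_torus_regular_of_nonsplit`
with `φ = χ₀`, the integrand collapse (§1), `∫_{K₂ × N₂} 1_{S₀}(n) = κ₂(K₂)·μ(S₀)`, the line stratum `μ(S₀) = q⁻¹·μ(N₂ ∩ K₂)` (★ FILE 1); `κ₂(K₂)`, `μ(N₂ ∩ K₂)` cancel.
Decidability binder `χdec` (any instance: pass `_`). [cite: Rogawski1990, §4.9 Prop. 4.9.1 (b) p. 55; §4.3 (4.3.1) p. 43] [cite: Flicker1998UnitaryFL, §2] -/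
theorem classOrbitalIntegral_chiZero_eq_of_torus_deep
    [MeasurableSpace ((cmDatum L 2 (Matrix.of fun i j : Fin 2 => if i.val + j.val + 1 = 2 then (1 : L) else 0)).Local v × (cmDatum L 1 (Matrix.of fun i j : Fin 1 => if i.val + j.val + 1 = 1 then (1 : L) else 0)).Local v)] [BorelSpace ((cmDatum L 2 (Matrix.of fun i j : Fin 2 => if i.val + j.val + 1 = 2 then (1 : L) else 0)).Local v × (cmDatum L 1 (Matrix.of fun i j : Fin 1 => if i.val + j.val + 1 = 1 then (1 : L) else 0)).Local v)]
    [∀ a : ((cmDatum L 2 (Matrix.of fun i j : Fin 2 => if i.val + j.val + 1 = 2 then (1 : L) else 0)).Local v × (cmDatum L 1 (Matrix.of fun i j : Fin 1 => if i.val + j.val + 1 = 1 then (1 : L) else 0)).Local v), MeasurableSpace (((cmDatum L 2 (Matrix.of fun i j : Fin 2 => if i.val + j.val + 1 = 2 then (1 : L) else 0)).Local v × (cmDatum L 1 (Matrix.of fun i j : Fin 1 => if i.val + j.val + 1 = 1 then (1 : L) else 0)).Local v) ⧸ Subgroup.centralizer ({a} : Set ((cmDatum L 2 (Matrix.of fun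 i j : Fin 2 => if i.val + j.val + 1 = 2 then (1 : L) else 0)).Local v × (cmDatum L 1 (Matrix.of fun i j : Fin 1 => if i.val + j.val + 1 = 1 then (1 : L) else 0)).Local v)))]
    [∀ a : ((cmDatum L 2 (Matrix.of fun i j : Fin 2 => if i.val + j.val + 1 = 2 then (1 : L) else 0)).Local v × (cmDatum L 1 (Matrix.of fun i j : Fin 1 => if i.val + j.val + 1 = 1 then (1 : L) else 0)).Local v), BorelSpace (((cmDatum L 2 (Matrix.of fun i j : Fin 2 => if i.val + j.val + 1 = 2 then (1 : L) else 0)).Local v × (cmDatum L 1 (Matrix.of fun i j : Fin 1 => if i.val + j.val + 1 = 1 then (1 : L) else 0)).Local v) ⧸ Subgroup.centralizer ({a} : Set ((cmDatum L 2 (Matrix.of fun i j : Fin 2 => if i.val + j.val + 1 = 2 then (1 : L) else 0)).Local v × (cmDatum L 1 (Matrix.of fun i j : Fin 1 => if i.val + j.val + 1 = 1 then (1 : L) else 0)).Local v)))]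
    (νH : Measure ((cmDatum L 2 (Matrix.of fun i j : Fin 2 => if i.val + j.val + 1 = 2 then (1 : L) else 0)).Local v × (cmDatum L 1 (Matrix.of fun i j : Fin 1 => if i.val + j.val + 1 = 1 then (1 : L) else 0)).Local v)) [νH.IsHaarMeasure] [νH.IsMulRightInvariant]
    {P_H : ((cmDatum L 2 (Matrix.of fun i j : Fin 2 => if i.val + j.val + 1 = 2 then (1 : L) else 0)).Local v × (cmDatum L 1 (Matrix.of fun i j : Fin 1 => if i.val + j.val + 1 = 1 then (1 : L) else 0)).Local v) → Prop} {mH : OrbitalMeasureFamily ((cmDatum L 2 (Matrix.of fun i j : Fin 2 => if i.val + j.val + 1 = 2 then (1 : L) else 0)).Local v × (cmDatum L 1 (Matrix.of fun i j : Fin 1 => if i.val + j.val + 1 = 1 then (1 : L) else 0)).Local v)} (hmH : mH.IsCanonical P_H νH)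
    (hv : Algebra.IsUnramifiedIn (𝓞 L) v.asIdeal)
    (t : ↥(cmBorelTriple L 2 v).M) {d : Fin 2 → (LocalRing L v)ˣ}
    (hd : glDiagonal 2 (LocalRing L v) d = ((t : ↥(unitaryGroupOfForm (conjLocal L (IsCMField.complexConj L) v) (cmLocalForm L 2 v))) : GL (Fin 2) (LocalRing L v)))
    (hb : IsUnit ((((d 0)⁻¹ * d 1 : (LocalRing L v)ˣ) : LocalRing L v) - 1))
    (hreg₂ : IsRegularElt ((t : ↥(unitaryGroupOfForm (conjLocal L (IsCMField.complexConj L) v) (cmLocalForm L 2 v))) : GL (Fin 2) (LocalRing L v)))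
    (ht1 : ∀ i : Fin 2, Valued.v ((((d i : (LocalRing L v)ˣ) : LocalRing L v) w) - 1) < 1)
    (u : (cmDatum L 1 (Matrix.of fun i j : Fin 1 => if i.val + j.val + 1 = 1 then (1 : L) else 0)).Local v) (hPH : P_H (Quotient.out (ConjClasses.mk (((t : ↥(unitaryGroupOfForm (conjLocal L (IsCMField.complexConj L) v) (cmLocalForm L 2 v))) : (cmDatum L 2 (Matrix.of fun i j : Fin 2 => if i.val + j.val + 1 = 2 then (1 : L) else 0)).Local v), u))))
    (hK₁ : ∀ x : (cmDatum L 1 (Matrix.of fun i j : Fin 1 => if i.val + j.val + 1 = 1 then (1 : L) else 0)).Local v, x ∈ cmLocalIntegralLevel L 1 (Matrix.of fun i j : Fin 1 => if i.val + j.val + 1 = 1 then (1 : L) else 0) v)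
    (χdec : ∀ h : ((cmDatum L 2 (Matrix.of fun i j : Fin 2 => if i.val + j.val + 1 = 2 then (1 : L) else 0)).Local v × (cmDatum L 1 (Matrix.of fun i j : Fin 1 => if i.val + j.val + 1 = 1 then (1 : L) else 0)).Local v), Decidable ((redMat (((h).1.val : GL (Fin 2) (UnitaryGroup.LocalRing L v)).val.map (Pi.evalRingHom (fun w' : PlacesOver L v => w'.1.adicCompletion L) w)) - 1) ^ 2 = 0 ∧ (redMat (((h).1.val : GL (Fin 2) (UnitaryGroup.LocalRing L v)).val.map (Pi.evalRingHom (fun w' : PlacesOver L v => w'.1.adicCompletion L) w)) - 1).rank = 0)) :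
    classOrbitalIntegral mH ((((((cmLocalIntegralLevel L 2 (Matrix.of fun i j : Fin 2 => if i.val + j.val + 1 = 2 then (1 : L) else 0) v).prod (cmLocalIntegralLevel L 1 (Matrix.of fun i j : Fin 1 => if i.val + j.val + 1 = 1 then (1 : L) else 0) v)) : Subgroup ((cmDatum L 2 (Matrix.of fun i j : Fin 2 => if i.val + j.val + 1 = 2 then (1 : L) else 0)).Local v × (cmDatum L 1 (Matrix.of fun i j : Fin 1 => if i.val + j.val + 1 = 1 then (1 : L) else 0)).Local v)) : Set ((cmDatum L 2 (Matrix.of fun i j : Fin 2 => if i.val + j.val + 1 = 2 then (1 : L) else 0)).Local v × (cmDatum L 1 (Matrix.of fun i j : Fin 1 => if i.val + j.val + 1 = 1 then (1 : L) else 0)).Local v)).indicator fun h => if (redMat (((h).1.val : GL (Fin 2) (UnitaryGroup.LocalRing L v)).val.map (Pi.evalRingHom (fun w' : PlacesOver L v => w'.1.adicCompletion L) w)) - 1) ^ 2 = 0 ∧ (redMat (((h).1.val : GL (Fin 2) (UnitaryGroup.LocalRing L v)).val.map (Pi.evalRingHom (fun w' : PlacesOver L v => w'.1.adicCompletion L)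 w)) - 1).rank = 0 then (1 : ℂ) else 0))
        (ConjClasses.mk (((t : ↥(unitaryGroupOfForm (conjLocal L (IsCMField.complexConj L) v) (cmLocalForm L 2 v))) : (cmDatum L 2 (Matrix.of fun i j : Fin 2 => if i.val + j.val + 1 = 2 then (1 : L) else 0)).Local v), u)) =
      (νH.real ((((cmLocalIntegralLevel L 2 (Matrix.of fun i j : Fin 2 => if i.val + j.val + 1 = 2 then (1 : L) else 0) v).prod (cmLocalIntegralLevel L 1 (Matrix.of fun i j : Fin 1 => if i.val + j.val + 1 = 1 then (1 : L) else 0) v)) : Subgroup ((cmDatum L 2 (Matrix.of fun i j : Fin 2 => if i.val + j.val + 1 = 2 then (1 : L) else 0)).Local v × (cmDatum L 1 (Matrix.of fun i j : Fin 1 => if i.val + j.val + 1 = 1 then (1 : L) else 0)).Local v)) : Set ((cmDatum L 2 (Matrix.of fun i j : Fin 2 => if i.val + j.val + 1 = 2 then (1 : L) else 0)).Local v × (cmDatum L 1 (Matrix.of fun i j : Fin 1 => if i.val + j.val + 1 = 1 then (1 : L) else 0)).Local v)) : ℂ) *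
        (((letI : MeasurableSpace (LocalRing L v) := borel _; haveI : BorelSpace (LocalRing L v) := ⟨rfl⟩
          haveI : SecondCountableTopology (LocalRing L v) := secondCountableTopology_localRing (E := L) v
          ((skewModulus (conjLocal L (IsCMField.complexConj L) v) (continuous_conjLocal L (IsCMField.complexConj L) v) hb.unit
            (map_unit_torusScalar_sub_one_two (conjLocal L (IsCMField.complexConj L) v) (cmLocalForm_eq_over L 2 v)
              (⟨(t : ↥(unitaryGroupOfForm (conjLocal L (IsCMField.complexConj L) v) (cmLocalForm L 2 v))), t.2⟩ : ↥(torusU (conjLocal L (IsCMField.complexConj L) v) (cmLocalForm L 2 v))) hd hb))⁻¹ : ℝ≥0)) : ℝ≥0) : ℂ) *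
        ((Ideal.absNorm v.asIdeal : ℂ))⁻¹ := by
  haveI : Algebra.IsQuadraticExtension ↥(maximalRealSubfield L) L := IsCMField.isQuadraticExtension L
  -- measurable structures and Haar measures on `U(Φ₂)(L⁺_v) ⊇ K₂, N₂` (they cancel in the end)
  haveI : LocallyCompactSpace ↥(unitaryGroupOfForm (conjLocal L (IsCMField.complexConj L) v) (cmLocalForm L 2 v)) := locallyCompactSpace_local (IsCMField.complexConj L) 2 _ v
  haveI : SecondCountableTopology ↥(unitaryGroupOfForm (conjLocal L (IsCMField.complexConj L) v) (cmLocalForm L 2 v)) := secondCountableTopology_local (IsCMField.complexConj L) 2 _ v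
  letI mU : MeasurableSpace ↥(unitaryGroupOfForm (conjLocal L (IsCMField.complexConj L) v) (cmLocalForm L 2 v)) := borel _
  haveI : BorelSpace ↥(unitaryGroupOfForm (conjLocal L (IsCMField.complexConj L) v) (cmLocalForm L 2 v)) := ⟨rfl⟩
  obtain ⟨K₂, hK2⟩ : ∃ K : Subgroup ↥(unitaryGroupOfForm (conjLocal L (IsCMField.complexConj L) v) (cmLocalForm L 2 v)), K = cmLocalIntegralLevel L 2 (Matrix.of fun i j : Fin 2 => if i.val + j.val + 1 = 2 then (1 : L) else 0) v := ⟨_, rfl⟩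
  have hK2co : IsCompact (K₂ : Set ↥(unitaryGroupOfForm (conjLocal L (IsCMField.complexConj L) v) (cmLocalForm L 2 v))) ∧ IsOpen (K₂ : Set ↥(unitaryGroupOfForm (conjLocal L (IsCMField.complexConj L) v) (cmLocalForm L 2 v))) := by
    rw [hK2]; exact isCompact_isOpen_cmLocalIntegralLevel L 2 (Matrix.of fun i j : Fin 2 => if i.val + j.val + 1 = 2 then (1 : L) else 0) v
  haveI : LocallyCompactSpace ↥K₂ := hK2co.1.isClosed.isClosedEmbedding_subtypeVal.locallyCompactSpace
  haveI : CompactSpace ↥K₂ := isCompact_iff_compactSpace.1 hK2co.1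
  have hN₂ : IsClosed (((unipotentU (conjLocal L (IsCMField.complexConj L) v) (cmLocalForm L 2 v))) : Set ↥(unitaryGroupOfForm (conjLocal L (IsCMField.complexConj L) v) (cmLocalForm L 2 v))) := isClosed_unipotentU _ _
  haveI : LocallyCompactSpace ↥(cmBorelTriple L 2 v).N := hN₂.isClosedEmbedding_subtypeVal.locallyCompactSpace
  haveI : SecondCountableTopology ↥(cmBorelTriple L 2 v).N := TopologicalSpace.Subtype.secondCountableTopology _
  haveI : SigmaCompactSpace ↥(cmBorelTriple L 2 v).N := sigmaCompactSpace_of_locallyCompact_secondCountable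
  obtain ⟨κ₂, hκ₂⟩ : ∃ κ : Measure ↥K₂, κ = Measure.haar := ⟨_, rfl⟩
  haveI : κ₂.IsHaarMeasure := by rw [hκ₂]; infer_instance
  obtain ⟨μN₂, hμN₂⟩ : ∃ μ : Measure ↥(cmBorelTriple L 2 v).N, μ = Measure.haar := ⟨_, rfl⟩
  haveI : μN₂.IsHaarMeasure := by rw [hμN₂]; infer_instance
  haveI : SigmaFinite μN₂ := inferInstance
  -- the class function `χ_s` is measurable (locally constant, ★ END FILE B)
  have hχ : Measurable (((((cmLocalIntegralLevel L 2 (Matrix.of fun i j : Fin 2 => if i.val + j.val + 1 = 2 then (1 : L) else 0) v).prod (cmLocalIntegralLevel L 1 (Matrix.of fun i j : Fin 1 => if i.val + j.val + 1 = 1 then (1 : L) else 0) v)) : Subgroup (((cmDatum L 2 (Matrix.of fun i j : Fin 2 => if i.val + j.val + 1 = 2 then (1 : L) else 0)).Local v) × ((cmDatum L 1 (Matrix.of fun i j : Fin 1 => if i.val + j.val + 1 = 1 then (1 : L) else 0)).Local v))) : Set (((cmDatum L 2 (Matrix.of fun i j : Fin 2 => if i.val + j.val + 1 = 2 then (1 :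 L) else 0)).Local v) × ((cmDatum L 1 (Matrix.of fun i j : Fin 1 => if i.val + j.val + 1 = 1 then (1 : L) else 0)).Local v))).indicator fun h => if (redMat (((h).1.val : GL (Fin 2) (UnitaryGroup.LocalRing L v)).val.map (Pi.evalRingHom (fun w' : PlacesOver L v => w'.1.adicCompletion L) w)) - 1) ^ 2 = 0 ∧ (redMat (((h).1.val : GL (Fin 2) (UnitaryGroup.LocalRing L v)).val.map (Pi.evalRingHom (fun w' : PlacesOver L v => w'.1.adicCompletion L) w)) - 1).rank = 0 then (1 : ℂ) else 0) :=
    (isLocSmooth_indicator_ite_redMat L v w hw 0 χdec).continuous.measurable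
  -- ★ H-descent
  rw [classOrbitalIntegral_prod_eq_smul_integral_prod_of_torus_regular_of_nonsplit L w hw νH hmH K₂ hK2 κ₂ μN₂ t hd hb hreg₂ u hPH hK₁ _ hχ]
  -- positivity ∕ finiteness of `κ₂(K₂)` and `μ(N₂ ∩ K₂)`
  have hκ0 : κ₂ Set.univ ≠ 0 := IsOpenPosMeasure.open_pos _ isOpen_univ Set.univ_nonempty
  have hκt : κ₂ Set.univ ≠ ∞ := (isCompact_univ.measure_lt_top (μ := κ₂)).ne
  have hA0 : μN₂ {n : ↥(cmBorelTriple L 2 v).N | (n : ↥(unitaryGroupOfForm (conjLocal L (IsCMField.complexConj L) v) (cmLocalForm L 2 v))) ∈ K₂} ≠ 0 :=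
    (hK2co.2.preimage continuous_subtype_val).measure_ne_zero μN₂
      ⟨1, by simp only [Set.mem_preimage, OneMemClass.coe_one, SetLike.mem_coe]; exact one_mem _⟩
  have hAt : μN₂ {n : ↥(cmBorelTriple L 2 v).N | (n : ↥(unitaryGroupOfForm (conjLocal L (IsCMField.complexConj L) v) (cmLocalForm L 2 v))) ∈ K₂} ≠ ∞ :=
    (hN₂.isClosedEmbedding_subtypeVal.isCompact_preimage hK2co.1).measure_lt_top.ne
  -- the two spellings of `N₂ ∩ K₂` (`K₂` as a subgroup of `U(Φ₂)(L⁺_v)` ∕ of `H_{2,v}`) agree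
  have hAK : {n : ↥(cmBorelTriple L 2 v).N | (n : ↥(unitaryGroupOfForm (conjLocal L (IsCMField.complexConj L) v) (cmLocalForm L 2 v))) ∈ K₂} = {n : ↥(cmBorelTriple L 2 v).N | (n : ↥(unitaryGroupOfForm (conjLocal L (IsCMField.complexConj L) v) (cmLocalForm L 2 v))) ∈ cmLocalIntegralLevel L 2 (Matrix.of fun i j : Fin 2 => if i.val + j.val + 1 = 2 then (1 : L) else 0) v} := by
    rw [hK2]; rfl
  rw [hAK] at hA0 hAt ⊢
  -- the integrand collapse (§1): the integrand is `1_{S_s}(n)`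
  have hint : (∫ p : ↥K₂ × ↥(cmBorelTriple L 2 v).N,
        (((((cmLocalIntegralLevel L 2 (Matrix.of fun i j : Fin 2 => if i.val + j.val + 1 = 2 then (1 : L) else 0) v).prod (cmLocalIntegralLevel L 1 (Matrix.of fun i j : Fin 1 => if i.val + j.val + 1 = 1 then (1 : L) else 0) v)) : Subgroup (((cmDatum L 2 (Matrix.of fun i j : Fin 2 => if i.val + j.val + 1 = 2 then (1 : L) else 0)).Local v) × ((cmDatum L 1 (Matrix.of fun i j : Fin 1 => if i.val + j.val + 1 = 1 then (1 : L) else 0)).Local v))) : Set (((cmDatum L 2 (Matrix.of fun i j : Fin 2 => if i.val + j.val + 1 = 2 then (1 : L) else 0)).Local v) × ((cmDatum L 1 (Matrix.of fun i j : Fin 1 => if i.val + j.val + 1 = 1 then (1 : L) else 0)).Local v))).indicator fun h => if (redMat (((h).1.val : GL (Fin 2) (UnitaryGroup.LocalRing L v)).val.map (Pi.evalRingHom (fun w' : PlacesOver L v => w'.1.adicCompletion L) w)) - 1) ^ 2 = 0 ∧ (redMat (((h).1.val : GL (Fin 2) (UnitaryGroup.LocalRing L v)).val.map (Pi.evalRingHom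 (fun w' : PlacesOver L v => w'.1.adicCompletion L) w)) - 1).rank = 0 then (1 : ℂ) else 0)
          (((((p.1 : ↥(unitaryGroupOfForm (conjLocal L (IsCMField.complexConj L) v) (cmLocalForm L 2 v))) * ((t : ↥(unitaryGroupOfForm (conjLocal L (IsCMField.complexConj L) v) (cmLocalForm L 2 v))) * (p.2 : ↥(unitaryGroupOfForm (conjLocal L (IsCMField.complexConj L) v) (cmLocalForm L 2 v))))) * (p.1 : ↥(unitaryGroupOfForm (conjLocal L (IsCMField.complexConj L) v) (cmLocalForm L 2 v)))⁻¹ : ↥(unitaryGroupOfForm (conjLocal L (IsCMField.complexConj L) v) (cmLocalForm L 2 v))) : ((cmDatum L 2 (Matrix.of fun i j : Fin 2 => if i.val + j.val + 1 = 2 then (1 : L) else 0)).Local v)), u) ∂(κ₂.prod μN₂)) =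
      ∫ p : ↥K₂ × ↥(cmBorelTriple L 2 v).N, ({n : ↥(cmBorelTriple L 2 v).N | (n : ↥(unitaryGroupOfForm (conjLocal L (IsCMField.complexConj L) v) (cmLocalForm L 2 v))) ∈ cmLocalIntegralLevel L 2 (Matrix.of fun i j : Fin 2 => if i.val + j.val + 1 = 2 then (1 : L) else 0) v ∧ ((redMat ((((n : ↥(unitaryGroupOfForm (conjLocal L (IsCMField.complexConj L) v) (cmLocalForm L 2 v))) : GL (Fin 2) (LocalRing L v)).val.map (Pi.evalRingHom (fun w' : PlacesOver L v => w'.1.adicCompletion L) w))) - 1) ^ 2 = 0 ∧ (redMat ((((n : ↥(unitaryGroupOfForm (conjLocal L (IsCMField.complexConj L) v) (cmLocalForm L 2 v))) : GL (Fin 2) (LocalRing L v)).val.map (Pi.evalRingHom (fun w' : PlacesOver L v => w'.1.adicCompletion L) w))) - 1).rank = 0)}).indicator (fun _ => (1 : ℂ)) p.2 ∂(κ₂.prod μN₂) := by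
    congr 1
    funext p
    exact indicator_ite_redMat_conj_torus_mul_eq L v w hw 0 χdec hK₁ (k := (p.1 : ↥(unitaryGroupOfForm (conjLocal L (IsCMField.complexConj L) v) (cmLocalForm L 2 v)))) (by rw [← hK2]; exact p.1.2) t hd ht1 p.2 u
  -- `S_s` is measurable: the preimage of a ball∕sphere of `L_w` under the continuous coordinate `n ↦ n₀₁,w`
  have hcont : Continuous fun n : ↥(cmBorelTriple L 2 v).N => (((((n : ↥(unitaryGroupOfForm (conjLocal L (IsCMField.complexConj L) v) (cmLocalForm L 2 v))) : GL (Fin 2) (LocalRing L v)) : Matrix (Fin 2) (Fin 2) (LocalRing L v)) 0 1) w) :=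
    (continuous_apply w).comp (continuous_umat_zero_one_two (conjLocal L (IsCMField.complexConj L) v))
  have hSmeas : MeasurableSet ({n : ↥(cmBorelTriple L 2 v).N | (n : ↥(unitaryGroupOfForm (conjLocal L (IsCMField.complexConj L) v) (cmLocalForm L 2 v))) ∈ cmLocalIntegralLevel L 2 (Matrix.of fun i j : Fin 2 => if i.val + j.val + 1 = 2 then (1 : L) else 0) v ∧ ((redMat ((((n : ↥(unitaryGroupOfForm (conjLocal L (IsCMField.complexConj L) v) (cmLocalForm L 2 v))) : GL (Fin 2) (LocalRing L v)).val.map (Pi.evalRingHom (fun w' : PlacesOver L v => w'.1.adicCompletion L) w))) - 1) ^ 2 = 0 ∧ (redMat ((((n : ↥(unitaryGroupOfForm (conjLocal L (IsCMField.complexConj L) v) (cmLocalForm L 2 v))) : GL (Fin 2) (LocalRing L v)).val.map (Pi.evalRingHom (fun w' : PlacesOver L v => w'.1.adicCompletion L) w))) - 1).rank = 0)}) := by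
    have hS : ({n : ↥(cmBorelTriple L 2 v).N | (n : ↥(unitaryGroupOfForm (conjLocal L (IsCMField.complexConj L) v) (cmLocalForm L 2 v))) ∈ cmLocalIntegralLevel L 2 (Matrix.of fun i j : Fin 2 => if i.val + j.val + 1 = 2 then (1 : L) else 0) v ∧ ((redMat ((((n : ↥(unitaryGroupOfForm (conjLocal L (IsCMField.complexConj L) v) (cmLocalForm L 2 v))) : GL (Fin 2) (LocalRing L v)).val.map (Pi.evalRingHom (fun w' : PlacesOver L v => w'.1.adicCompletion L) w))) - 1) ^ 2 = 0 ∧ (redMat ((((n : ↥(unitaryGroupOfForm (conjLocal L (IsCMField.complexConj L) v) (cmLocalForm L 2 v))) : GL (Fin 2) (LocalRing L v)).val.map (Pi.evalRingHom (fun w' : PlacesOver L v => w'.1.adicCompletion L) w))) - 1).rank = 0)}) =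
        (fun n : ↥(cmBorelTriple L 2 v).N => (((((n : ↥(unitaryGroupOfForm (conjLocal L (IsCMField.complexConj L) v) (cmLocalForm L 2 v))) : GL (Fin 2) (LocalRing L v)) : Matrix (Fin 2) (Fin 2) (LocalRing L v)) 0 1) w)) ⁻¹' {z : w.1.adicCompletion L | Valued.v z < 1} := by
      ext n
      simp only [Set.mem_setOf_eq, Set.mem_preimage]
      rw [unipotent_mem_cmLocalIntegralLevel_iff L v w hw]
      constructor
      · rintro ⟨hle, -, h0⟩
        exact (rank_redMat_unipotent_sub_one_eq_zero_iff L v w n hle).1 h0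
      · intro hlt
        exact ⟨hlt.le, sq_redMat_unipotent_sub_one L v w n, (rank_redMat_unipotent_sub_one_eq_zero_iff L v w n hlt.le).2 hlt⟩
    rw [hS]
    exact ((isOpen_setOf_valued_lt_one L v w).preimage hcont).measurableSet
  -- evaluate the Iwasawa integral: `κ₂(K₂) · μ(S_s)`
  rw [hint, integral_fun_snd, integral_indicator_const (1 : ℂ) hSmeas, measureReal_lineStratum_zero L v w hw μN₂ hv, smul_smul, smul_smul,
    Complex.real_smul, mul_one]
  -- cancel `κ₂(K₂)` and `μ(N₂ ∩ K₂)` (both positive and finite)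
  have hB : (((κ₂ Set.univ).toReal : ℝ) : ℂ) ≠ 0 := by exact_mod_cast ENNReal.toReal_ne_zero.2 ⟨hκ0, hκt⟩
  have hC : (((μN₂ {n : ↥(cmBorelTriple L 2 v).N | (n : ↥(unitaryGroupOfForm (conjLocal L (IsCMField.complexConj L) v) (cmLocalForm L 2 v))) ∈ cmLocalIntegralLevel L 2 (Matrix.of fun i j : Fin 2 => if i.val + j.val + 1 = 2 then (1 : L) else 0) v}).toReal : ℝ) : ℂ) ≠ 0 := by
    exact_mod_cast ENNReal.toReal_ne_zero.2 ⟨hA0, hAt⟩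
  have hq : (Ideal.absNorm v.asIdeal : ℂ) ≠ 0 := Nat.cast_ne_zero.2 fun h => v.ne_bot (Ideal.absNorm_eq_zero_iff.1 h)
  have hJ : (((letI : MeasurableSpace (LocalRing L v) := borel _; haveI : BorelSpace (LocalRing L v) := ⟨rfl⟩
          haveI : SecondCountableTopology (LocalRing L v) := secondCountableTopology_localRing (E := L) v
          (skewModulus (conjLocal L (IsCMField.complexConj L) v) (continuous_conjLocal L (IsCMField.complexConj L) v) hb.unit
            (map_unit_torusScalar_sub_one_two (conjLocal L (IsCMField.complexConj L) v) (cmLocalForm_eq_over L 2 v)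
              (⟨(t : ↥(unitaryGroupOfForm (conjLocal L (IsCMField.complexConj L) v) (cmLocalForm L 2 v))), t.2⟩ : ↥(torusU (conjLocal L (IsCMField.complexConj L) v) (cmLocalForm L 2 v))) hd hb)) : ℝ≥0) : ℝ) : ℂ) ≠ 0 := by
    letI : MeasurableSpace (LocalRing L v) := borel _
    haveI : BorelSpace (LocalRing L v) := ⟨rfl⟩
    haveI : SecondCountableTopology (LocalRing L v) := secondCountableTopology_localRing (E := L) v
    exact_mod_cast (skewModulus_pos (conjLocal L (IsCMField.complexConj L) v) (continuous_conjLocal L (IsCMField.complexConj L) v) _ _).ne'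
  simp only [measureReal_def, ENNReal.toReal_mul, ENNReal.toReal_div, ENNReal.coe_toReal]
  push_cast
  field_simp

set_option maxHeartbeats 3200000 in
set_option synthInstance.maxHeartbeats 400000 in
-- instance-term unification on the CM local carriers, as above
include hw in
/-- **L-δ HEAD (χ₁): `Φ_H(⟦(t, u)⟧, χ₁) = ν_H(K₂ × K₁) · J_H(t) · q⁻¹ · (q − 1)`** for HEAD v4's `χ₁ = 1_{K_H}·[(red h_{W,w} − 1)² = 0 ∧ rank(red h_{W,w} − 1) = 1]`, same frame
as the `χ₀` head (rank-1 line stratum `μ(S₁) = (1 − q⁻¹)·μ(N₂ ∩ K₂)`). [cite: Rogawski1990, §4.9 Prop. 4.9.1 (b) p. 55; §4.3 (4.3.1) p. 43] [cite: Flicker1998UnitaryFL, §2] -/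
theorem classOrbitalIntegral_chiOne_eq_of_torus_deep
    [MeasurableSpace ((cmDatum L 2 (Matrix.of fun i j : Fin 2 => if i.val + j.val + 1 = 2 then (1 : L) else 0)).Local v × (cmDatum L 1 (Matrix.of fun i j : Fin 1 => if i.val + j.val + 1 = 1 then (1 : L) else 0)).Local v)] [BorelSpace ((cmDatum L 2 (Matrix.of fun i j : Fin 2 => if i.val + j.val + 1 = 2 then (1 : L) else 0)).Local v × (cmDatum L 1 (Matrix.of fun i j : Fin 1 => if i.val + j.val + 1 = 1 then (1 : L) else 0)).Local v)]
    [∀ a : ((cmDatum L 2 (Matrix.of fun i j : Fin 2 => if i.val + j.val + 1 = 2 then (1 : L) else 0)).Local v × (cmDatum L 1 (Matrix.of fun i j : Fin 1 => if i.val + j.val + 1 = 1 then (1 : L) else 0)).Local v), MeasurableSpace (((cmDatum L 2 (Matrix.of fun i j : Fin 2 => if i.val + j.val + 1 = 2 then (1 : L) else 0)).Local v × (cmDatum L 1 (Matrix.of fun i j : Fin 1 => if i.val + j.val + 1 = 1 then (1 : L) else 0)).Local v) ⧸ Subgroup.centralizer ({a} : Set ((cmDatum L 2 (Matrix.of fun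 i j : Fin 2 => if i.val + j.val + 1 = 2 then (1 : L) else 0)).Local v × (cmDatum L 1 (Matrix.of fun i j : Fin 1 => if i.val + j.val + 1 = 1 then (1 : L) else 0)).Local v)))]
    [∀ a : ((cmDatum L 2 (Matrix.of fun i j : Fin 2 => if i.val + j.val + 1 = 2 then (1 : L) else 0)).Local v × (cmDatum L 1 (Matrix.of fun i j : Fin 1 => if i.val + j.val + 1 = 1 then (1 : L) else 0)).Local v), BorelSpace (((cmDatum L 2 (Matrix.of fun i j : Fin 2 => if i.val + j.val + 1 = 2 then (1 : L) else 0)).Local v × (cmDatum L 1 (Matrix.of fun i j : Fin 1 => if i.val + j.val + 1 = 1 then (1 : L) else 0)).Local v) ⧸ Subgroup.centralizer ({a} : Set ((cmDatum L 2 (Matrix.of fun i j : Fin 2 => if i.val + j.val + 1 = 2 then (1 : L) else 0)).Local v × (cmDatum L 1 (Matrix.of fun i j : Fin 1 => if i.val + j.val + 1 = 1 then (1 : L) else 0)).Local v)))]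
    (νH : Measure ((cmDatum L 2 (Matrix.of fun i j : Fin 2 => if i.val + j.val + 1 = 2 then (1 : L) else 0)).Local v × (cmDatum L 1 (Matrix.of fun i j : Fin 1 => if i.val + j.val + 1 = 1 then (1 : L) else 0)).Local v)) [νH.IsHaarMeasure] [νH.IsMulRightInvariant]
    {P_H : ((cmDatum L 2 (Matrix.of fun i j : Fin 2 => if i.val + j.val + 1 = 2 then (1 : L) else 0)).Local v × (cmDatum L 1 (Matrix.of fun i j : Fin 1 => if i.val + j.val + 1 = 1 then (1 : L) else 0)).Local v) → Prop} {mH : OrbitalMeasureFamily ((cmDatum L 2 (Matrix.of fun i j : Fin 2 => if i.val + j.val + 1 = 2 then (1 : L) else 0)).Local v × (cmDatum L 1 (Matrix.of fun i j : Fin 1 => if i.val + j.val + 1 = 1 then (1 : L) else 0)).Local v)} (hmH : mH.IsCanonical P_H νH)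
    (hv : Algebra.IsUnramifiedIn (𝓞 L) v.asIdeal)
    (t : ↥(cmBorelTriple L 2 v).M) {d : Fin 2 → (LocalRing L v)ˣ}
    (hd : glDiagonal 2 (LocalRing L v) d = ((t : ↥(unitaryGroupOfForm (conjLocal L (IsCMField.complexConj L) v) (cmLocalForm L 2 v))) : GL (Fin 2) (LocalRing L v)))
    (hb : IsUnit ((((d 0)⁻¹ * d 1 : (LocalRing L v)ˣ) : LocalRing L v) - 1))
    (hreg₂ : IsRegularElt ((t : ↥(unitaryGroupOfForm (conjLocal L (IsCMField.complexConj L) v) (cmLocalForm L 2 v))) : GL (Fin 2) (LocalRing L v)))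
    (ht1 : ∀ i : Fin 2, Valued.v ((((d i : (LocalRing L v)ˣ) : LocalRing L v) w) - 1) < 1)
    (u : (cmDatum L 1 (Matrix.of fun i j : Fin 1 => if i.val + j.val + 1 = 1 then (1 : L) else 0)).Local v) (hPH : P_H (Quotient.out (ConjClasses.mk (((t : ↥(unitaryGroupOfForm (conjLocal L (IsCMField.complexConj L) v) (cmLocalForm L 2 v))) : (cmDatum L 2 (Matrix.of fun i j : Fin 2 => if i.val + j.val + 1 = 2 then (1 : L) else 0)).Local v), u))))
    (hK₁ : ∀ x : (cmDatum L 1 (Matrix.of fun i j : Fin 1 => if i.val + j.val + 1 = 1 then (1 : L) else 0)).Local v, x ∈ cmLocalIntegralLevel L 1 (Matrix.of fun i j : Fin 1 => if i.val + j.val + 1 = 1 then (1 : L) else 0) v)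
    (χdec : ∀ h : ((cmDatum L 2 (Matrix.of fun i j : Fin 2 => if i.val + j.val + 1 = 2 then (1 : L) else 0)).Local v × (cmDatum L 1 (Matrix.of fun i j : Fin 1 => if i.val + j.val + 1 = 1 then (1 : L) else 0)).Local v), Decidable ((redMat (((h).1.val : GL (Fin 2) (UnitaryGroup.LocalRing L v)).val.map (Pi.evalRingHom (fun w' : PlacesOver L v => w'.1.adicCompletion L) w)) - 1) ^ 2 = 0 ∧ (redMat (((h).1.val : GL (Fin 2) (UnitaryGroup.LocalRing L v)).val.map (Pi.evalRingHom (fun w' : PlacesOver L v => w'.1.adicCompletion L) w)) - 1).rank = 1)) :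
    classOrbitalIntegral mH ((((((cmLocalIntegralLevel L 2 (Matrix.of fun i j : Fin 2 => if i.val + j.val + 1 = 2 then (1 : L) else 0) v).prod (cmLocalIntegralLevel L 1 (Matrix.of fun i j : Fin 1 => if i.val + j.val + 1 = 1 then (1 : L) else 0) v)) : Subgroup ((cmDatum L 2 (Matrix.of fun i j : Fin 2 => if i.val + j.val + 1 = 2 then (1 : L) else 0)).Local v × (cmDatum L 1 (Matrix.of fun i j : Fin 1 => if i.val + j.val + 1 = 1 then (1 : L) else 0)).Local v)) : Set ((cmDatum L 2 (Matrix.of fun i j : Fin 2 => if i.val + j.val + 1 = 2 then (1 : L) else 0)).Local v × (cmDatum L 1 (Matrix.of fun i j : Fin 1 => if i.val + j.val + 1 = 1 then (1 : L) else 0)).Local v)).indicator fun h => if (redMat (((h).1.val : GL (Fin 2) (UnitaryGroup.LocalRing L v)).val.map (Pi.evalRingHom (fun w' : PlacesOver L v => w'.1.adicCompletion L) w)) - 1) ^ 2 = 0 ∧ (redMat (((h).1.val : GL (Fin 2) (UnitaryGroup.LocalRing L v)).val.map (Pi.evalRingHom (fun w' : PlacesOver L v => w'.1.adicCompletion L)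 w)) - 1).rank = 1 then (1 : ℂ) else 0))
        (ConjClasses.mk (((t : ↥(unitaryGroupOfForm (conjLocal L (IsCMField.complexConj L) v) (cmLocalForm L 2 v))) : (cmDatum L 2 (Matrix.of fun i j : Fin 2 => if i.val + j.val + 1 = 2 then (1 : L) else 0)).Local v), u)) =
      (νH.real ((((cmLocalIntegralLevel L 2 (Matrix.of fun i j : Fin 2 => if i.val + j.val + 1 = 2 then (1 : L) else 0) v).prod (cmLocalIntegralLevel L 1 (Matrix.of fun i j : Fin 1 => if i.val + j.val + 1 = 1 then (1 : L) else 0) v)) : Subgroup ((cmDatum L 2 (Matrix.of fun i j : Fin 2 => if i.val + j.val + 1 = 2 then (1 : L) else 0)).Local v × (cmDatum L 1 (Matrix.of fun i j : Fin 1 => if i.val + j.val + 1 = 1 then (1 : L) else 0)).Local v)) : Set ((cmDatum L 2 (Matrix.of fun i j : Fin 2 => if i.val + j.val + 1 = 2 then (1 : L) else 0)).Local v × (cmDatum L 1 (Matrix.of fun i j : Fin 1 => if i.val + j.val + 1 = 1 then (1 : L) else 0)).Local v)) : ℂ) *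
        (((letI : MeasurableSpace (LocalRing L v) := borel _; haveI : BorelSpace (LocalRing L v) := ⟨rfl⟩
          haveI : SecondCountableTopology (LocalRing L v) := secondCountableTopology_localRing (E := L) v
          ((skewModulus (conjLocal L (IsCMField.complexConj L) v) (continuous_conjLocal L (IsCMField.complexConj L) v) hb.unit
            (map_unit_torusScalar_sub_one_two (conjLocal L (IsCMField.complexConj L) v) (cmLocalForm_eq_over L 2 v)
              (⟨(t : ↥(unitaryGroupOfForm (conjLocal L (IsCMField.complexConj L) v) (cmLocalForm L 2 v))), t.2⟩ : ↥(torusU (conjLocal L (IsCMField.complexConj L) v) (cmLocalForm L 2 v))) hd hb))⁻¹ : ℝ≥0)) : ℝ≥0) : ℂ) *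
        (((Ideal.absNorm v.asIdeal : ℂ))⁻¹ * ((Ideal.absNorm v.asIdeal : ℂ) - 1)) := by
  haveI : Algebra.IsQuadraticExtension ↥(maximalRealSubfield L) L := IsCMField.isQuadraticExtension L
  -- measurable structures and Haar measures on `U(Φ₂)(L⁺_v) ⊇ K₂, N₂` (they cancel in the end)
  haveI : LocallyCompactSpace ↥(unitaryGroupOfForm (conjLocal L (IsCMField.complexConj L) v) (cmLocalForm L 2 v)) := locallyCompactSpace_local (IsCMField.complexConj L) 2 _ v
  haveI : SecondCountableTopology ↥(unitaryGroupOfForm (conjLocal L (IsCMField.complexConj L) v) (cmLocalForm L 2 v)) := secondCountableTopology_local (IsCMField.complexConj L) 2 _ v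
  letI mU : MeasurableSpace ↥(unitaryGroupOfForm (conjLocal L (IsCMField.complexConj L) v) (cmLocalForm L 2 v)) := borel _
  haveI : BorelSpace ↥(unitaryGroupOfForm (conjLocal L (IsCMField.complexConj L) v) (cmLocalForm L 2 v)) := ⟨rfl⟩
  obtain ⟨K₂, hK2⟩ : ∃ K : Subgroup ↥(unitaryGroupOfForm (conjLocal L (IsCMField.complexConj L) v) (cmLocalForm L 2 v)), K = cmLocalIntegralLevel L 2 (Matrix.of fun i j : Fin 2 => if i.val + j.val + 1 = 2 then (1 : L) else 0) v := ⟨_, rfl⟩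
  have hK2co : IsCompact (K₂ : Set ↥(unitaryGroupOfForm (conjLocal L (IsCMField.complexConj L) v) (cmLocalForm L 2 v))) ∧ IsOpen (K₂ : Set ↥(unitaryGroupOfForm (conjLocal L (IsCMField.complexConj L) v) (cmLocalForm L 2 v))) := by
    rw [hK2]; exact isCompact_isOpen_cmLocalIntegralLevel L 2 (Matrix.of fun i j : Fin 2 => if i.val + j.val + 1 = 2 then (1 : L) else 0) v
  haveI : LocallyCompactSpace ↥K₂ := hK2co.1.isClosed.isClosedEmbedding_subtypeVal.locallyCompactSpace
  haveI : CompactSpace ↥K₂ := isCompact_iff_compactSpace.1 hK2co.1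
  have hN₂ : IsClosed (((unipotentU (conjLocal L (IsCMField.complexConj L) v) (cmLocalForm L 2 v))) : Set ↥(unitaryGroupOfForm (conjLocal L (IsCMField.complexConj L) v) (cmLocalForm L 2 v))) := isClosed_unipotentU _ _
  haveI : LocallyCompactSpace ↥(cmBorelTriple L 2 v).N := hN₂.isClosedEmbedding_subtypeVal.locallyCompactSpace
  haveI : SecondCountableTopology ↥(cmBorelTriple L 2 v).N := TopologicalSpace.Subtype.secondCountableTopology _
  haveI : SigmaCompactSpace ↥(cmBorelTriple L 2 v).N := sigmaCompactSpace_of_locallyCompact_secondCountable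
  obtain ⟨κ₂, hκ₂⟩ : ∃ κ : Measure ↥K₂, κ = Measure.haar := ⟨_, rfl⟩
  haveI : κ₂.IsHaarMeasure := by rw [hκ₂]; infer_instance
  obtain ⟨μN₂, hμN₂⟩ : ∃ μ : Measure ↥(cmBorelTriple L 2 v).N, μ = Measure.haar := ⟨_, rfl⟩
  haveI : μN₂.IsHaarMeasure := by rw [hμN₂]; infer_instance
  haveI : SigmaFinite μN₂ := inferInstance
  -- the class function `χ_s` is measurable (locally constant, ★ END FILE B)
  have hχ : Measurable (((((cmLocalIntegralLevel L 2 (Matrix.of fun i j : Fin 2 => if i.val + j.val + 1 = 2 then (1 : L) else 0) v).prod (cmLocalIntegralLevel L 1 (Matrix.of fun i j : Fin 1 => if i.val + j.val + 1 = 1 then (1 : L) else 0) v)) : Subgroup (((cmDatum L 2 (Matrix.of fun i j : Fin 2 => if i.val + j.val + 1 = 2 then (1 : L) else 0)).Local v) × ((cmDatum L 1 (Matrix.of fun i j : Fin 1 => if i.val + j.val + 1 = 1 then (1 : L) else 0)).Local v))) : Set (((cmDatum L 2 (Matrix.of fun i j : Fin 2 => if i.val + j.val + 1 = 2 then (1 :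 L) else 0)).Local v) × ((cmDatum L 1 (Matrix.of fun i j : Fin 1 => if i.val + j.val + 1 = 1 then (1 : L) else 0)).Local v))).indicator fun h => if (redMat (((h).1.val : GL (Fin 2) (UnitaryGroup.LocalRing L v)).val.map (Pi.evalRingHom (fun w' : PlacesOver L v => w'.1.adicCompletion L) w)) - 1) ^ 2 = 0 ∧ (redMat (((h).1.val : GL (Fin 2) (UnitaryGroup.LocalRing L v)).val.map (Pi.evalRingHom (fun w' : PlacesOver L v => w'.1.adicCompletion L) w)) - 1).rank = 1 then (1 : ℂ) else 0) :=
    (isLocSmooth_indicator_ite_redMat L v w hw 1 χdec).continuous.measurable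
  -- ★ H-descent
  rw [classOrbitalIntegral_prod_eq_smul_integral_prod_of_torus_regular_of_nonsplit L w hw νH hmH K₂ hK2 κ₂ μN₂ t hd hb hreg₂ u hPH hK₁ _ hχ]
  -- positivity ∕ finiteness of `κ₂(K₂)` and `μ(N₂ ∩ K₂)`
  have hκ0 : κ₂ Set.univ ≠ 0 := IsOpenPosMeasure.open_pos _ isOpen_univ Set.univ_nonempty
  have hκt : κ₂ Set.univ ≠ ∞ := (isCompact_univ.measure_lt_top (μ := κ₂)).ne
  have hA0 : μN₂ {n : ↥(cmBorelTriple L 2 v).N | (n : ↥(unitaryGroupOfForm (conjLocal L (IsCMField.complexConj L) v) (cmLocalForm L 2 v))) ∈ K₂} ≠ 0 :=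
    (hK2co.2.preimage continuous_subtype_val).measure_ne_zero μN₂
      ⟨1, by simp only [Set.mem_preimage, OneMemClass.coe_one, SetLike.mem_coe]; exact one_mem _⟩
  have hAt : μN₂ {n : ↥(cmBorelTriple L 2 v).N | (n : ↥(unitaryGroupOfForm (conjLocal L (IsCMField.complexConj L) v) (cmLocalForm L 2 v))) ∈ K₂} ≠ ∞ :=
    (hN₂.isClosedEmbedding_subtypeVal.isCompact_preimage hK2co.1).measure_lt_top.ne
  -- the two spellings of `N₂ ∩ K₂` (`K₂` as a subgroup of `U(Φ₂)(L⁺_v)` ∕ of `H_{2,v}`) agree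
  have hAK : {n : ↥(cmBorelTriple L 2 v).N | (n : ↥(unitaryGroupOfForm (conjLocal L (IsCMField.complexConj L) v) (cmLocalForm L 2 v))) ∈ K₂} = {n : ↥(cmBorelTriple L 2 v).N | (n : ↥(unitaryGroupOfForm (conjLocal L (IsCMField.complexConj L) v) (cmLocalForm L 2 v))) ∈ cmLocalIntegralLevel L 2 (Matrix.of fun i j : Fin 2 => if i.val + j.val + 1 = 2 then (1 : L) else 0) v} := by
    rw [hK2]; rfl
  rw [hAK] at hA0 hAt ⊢
  -- the integrand collapse (§1): the integrand is `1_{S_s}(n)`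
  have hint : (∫ p : ↥K₂ × ↥(cmBorelTriple L 2 v).N,
        (((((cmLocalIntegralLevel L 2 (Matrix.of fun i j : Fin 2 => if i.val + j.val + 1 = 2 then (1 : L) else 0) v).prod (cmLocalIntegralLevel L 1 (Matrix.of fun i j : Fin 1 => if i.val + j.val + 1 = 1 then (1 : L) else 0) v)) : Subgroup (((cmDatum L 2 (Matrix.of fun i j : Fin 2 => if i.val + j.val + 1 = 2 then (1 : L) else 0)).Local v) × ((cmDatum L 1 (Matrix.of fun i j : Fin 1 => if i.val + j.val + 1 = 1 then (1 : L) else 0)).Local v))) : Set (((cmDatum L 2 (Matrix.of fun i j : Fin 2 => if i.val + j.val + 1 = 2 then (1 : L) else 0)).Local v) × ((cmDatum L 1 (Matrix.of fun i j : Fin 1 => if i.val + j.val + 1 = 1 then (1 : L) else 0)).Local v))).indicator fun h => if (redMat (((h).1.val : GL (Fin 2) (UnitaryGroup.LocalRing L v)).val.map (Pi.evalRingHom (fun w' : PlacesOver L v => w'.1.adicCompletion L) w)) - 1) ^ 2 = 0 ∧ (redMat (((h).1.val : GL (Fin 2) (UnitaryGroup.LocalRing L v)).val.map (Pi.evalRingHom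 (fun w' : PlacesOver L v => w'.1.adicCompletion L) w)) - 1).rank = 1 then (1 : ℂ) else 0)
          (((((p.1 : ↥(unitaryGroupOfForm (conjLocal L (IsCMField.complexConj L) v) (cmLocalForm L 2 v))) * ((t : ↥(unitaryGroupOfForm (conjLocal L (IsCMField.complexConj L) v) (cmLocalForm L 2 v))) * (p.2 : ↥(unitaryGroupOfForm (conjLocal L (IsCMField.complexConj L) v) (cmLocalForm L 2 v))))) * (p.1 : ↥(unitaryGroupOfForm (conjLocal L (IsCMField.complexConj L) v) (cmLocalForm L 2 v)))⁻¹ : ↥(unitaryGroupOfForm (conjLocal L (IsCMField.complexConj L) v) (cmLocalForm L 2 v))) : ((cmDatum L 2 (Matrix.of fun i j : Fin 2 => if i.val + j.val + 1 = 2 then (1 : L) else 0)).Local v)), u) ∂(κ₂.prod μN₂)) =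
      ∫ p : ↥K₂ × ↥(cmBorelTriple L 2 v).N, ({n : ↥(cmBorelTriple L 2 v).N | (n : ↥(unitaryGroupOfForm (conjLocal L (IsCMField.complexConj L) v) (cmLocalForm L 2 v))) ∈ cmLocalIntegralLevel L 2 (Matrix.of fun i j : Fin 2 => if i.val + j.val + 1 = 2 then (1 : L) else 0) v ∧ ((redMat ((((n : ↥(unitaryGroupOfForm (conjLocal L (IsCMField.complexConj L) v) (cmLocalForm L 2 v))) : GL (Fin 2) (LocalRing L v)).val.map (Pi.evalRingHom (fun w' : PlacesOver L v => w'.1.adicCompletion L) w))) - 1) ^ 2 = 0 ∧ (redMat ((((n : ↥(unitaryGroupOfForm (conjLocal L (IsCMField.complexConj L) v) (cmLocalForm L 2 v))) : GL (Fin 2) (LocalRing L v)).val.map (Pi.evalRingHom (fun w' : PlacesOver L v => w'.1.adicCompletion L) w))) - 1).rank = 1)}).indicator (fun _ => (1 : ℂ)) p.2 ∂(κ₂.prod μN₂) := by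
    congr 1
    funext p
    exact indicator_ite_redMat_conj_torus_mul_eq L v w hw 1 χdec hK₁ (k := (p.1 : ↥(unitaryGroupOfForm (conjLocal L (IsCMField.complexConj L) v) (cmLocalForm L 2 v)))) (by rw [← hK2]; exact p.1.2) t hd ht1 p.2 u
  -- `S_s` is measurable: the preimage of a ball∕sphere of `L_w` under the continuous coordinate `n ↦ n₀₁,w`
  have hcont : Continuous fun n : ↥(cmBorelTriple L 2 v).N => (((((n : ↥(unitaryGroupOfForm (conjLocal L (IsCMField.complexConj L) v) (cmLocalForm L 2 v))) : GL (Fin 2) (LocalRing L v)) : Matrix (Fin 2) (Fin 2) (LocalRing L v)) 0 1) w) :=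
    (continuous_apply w).comp (continuous_umat_zero_one_two (conjLocal L (IsCMField.complexConj L) v))
  have hSmeas : MeasurableSet ({n : ↥(cmBorelTriple L 2 v).N | (n : ↥(unitaryGroupOfForm (conjLocal L (IsCMField.complexConj L) v) (cmLocalForm L 2 v))) ∈ cmLocalIntegralLevel L 2 (Matrix.of fun i j : Fin 2 => if i.val + j.val + 1 = 2 then (1 : L) else 0) v ∧ ((redMat ((((n : ↥(unitaryGroupOfForm (conjLocal L (IsCMField.complexConj L) v) (cmLocalForm L 2 v))) : GL (Fin 2) (LocalRing L v)).val.map (Pi.evalRingHom (fun w' : PlacesOver L v => w'.1.adicCompletion L) w))) - 1) ^ 2 = 0 ∧ (redMat ((((n : ↥(unitaryGroupOfForm (conjLocal L (IsCMField.complexConj L) v) (cmLocalForm L 2 v))) : GL (Fin 2) (LocalRing L v)).val.map (Pi.evalRingHom (fun w' : PlacesOver L v => w'.1.adicCompletion L) w))) - 1).rank = 1)}) := by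
    have hS : ({n : ↥(cmBorelTriple L 2 v).N | (n : ↥(unitaryGroupOfForm (conjLocal L (IsCMField.complexConj L) v) (cmLocalForm L 2 v))) ∈ cmLocalIntegralLevel L 2 (Matrix.of fun i j : Fin 2 => if i.val + j.val + 1 = 2 then (1 : L) else 0) v ∧ ((redMat ((((n : ↥(unitaryGroupOfForm (conjLocal L (IsCMField.complexConj L) v) (cmLocalForm L 2 v))) : GL (Fin 2) (LocalRing L v)).val.map (Pi.evalRingHom (fun w' : PlacesOver L v => w'.1.adicCompletion L) w))) - 1) ^ 2 = 0 ∧ (redMat ((((n : ↥(unitaryGroupOfForm (conjLocal L (IsCMField.complexConj L) v) (cmLocalForm L 2 v))) : GL (Fin 2) (LocalRing L v)).val.map (Pi.evalRingHom (fun w' : PlacesOver L v => w'.1.adicCompletion L) w))) - 1).rank = 1)}) =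
        (fun n : ↥(cmBorelTriple L 2 v).N => (((((n : ↥(unitaryGroupOfForm (conjLocal L (IsCMField.complexConj L) v) (cmLocalForm L 2 v))) : GL (Fin 2) (LocalRing L v)) : Matrix (Fin 2) (Fin 2) (LocalRing L v)) 0 1) w)) ⁻¹'
          ({z : w.1.adicCompletion L | Valued.v z ≤ 1} \ {z : w.1.adicCompletion L | Valued.v z < 1}) := by
      ext n
      simp only [Set.mem_setOf_eq, Set.mem_preimage, Set.mem_sdiff, not_lt]
      rw [unipotent_mem_cmLocalIntegralLevel_iff L v w hw, rank_redMat_unipotent_sub_one_eq_one_iff]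
      constructor
      · rintro ⟨hle, -, h1⟩
        exact ⟨hle, h1.ge⟩
      · rintro ⟨hle, hge⟩
        exact ⟨hle, sq_redMat_unipotent_sub_one L v w n, le_antisymm hle hge⟩
    have hcl : IsClosed {z : w.1.adicCompletion L | Valued.v z ≤ 1} := by
      have h : {z : w.1.adicCompletion L | Valued.v z ≤ 1} = ((Valued.v : Valuation (w.1.adicCompletion L) _).integer : Set (w.1.adicCompletion L)) := by
        ext z
        rw [Set.mem_setOf_eq, SetLike.mem_coe, Valuation.mem_integer_iff]
      rw [h]
      exact Valued.isClosed_integer (w.1.adicCompletion L)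
    rw [hS]
    exact ((hcl.sdiff (isOpen_setOf_valued_lt_one L v w)).preimage hcont).measurableSet
  -- evaluate the Iwasawa integral: `κ₂(K₂) · μ(S_s)`
  rw [hint, integral_fun_snd, integral_indicator_const (1 : ℂ) hSmeas, measureReal_lineStratum_one L v w hw μN₂ hv, smul_smul, smul_smul,
    Complex.real_smul, mul_one]
  -- cancel `κ₂(K₂)` and `μ(N₂ ∩ K₂)` (both positive and finite)
  have hB : (((κ₂ Set.univ).toReal : ℝ) : ℂ) ≠ 0 := by exact_mod_cast ENNReal.toReal_ne_zero.2 ⟨hκ0, hκt⟩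
  have hC : (((μN₂ {n : ↥(cmBorelTriple L 2 v).N | (n : ↥(unitaryGroupOfForm (conjLocal L (IsCMField.complexConj L) v) (cmLocalForm L 2 v))) ∈ cmLocalIntegralLevel L 2 (Matrix.of fun i j : Fin 2 => if i.val + j.val + 1 = 2 then (1 : L) else 0) v}).toReal : ℝ) : ℂ) ≠ 0 := by
    exact_mod_cast ENNReal.toReal_ne_zero.2 ⟨hA0, hAt⟩
  have hq : (Ideal.absNorm v.asIdeal : ℂ) ≠ 0 := Nat.cast_ne_zero.2 fun h => v.ne_bot (Ideal.absNorm_eq_zero_iff.1 h)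
  have hJ : (((letI : MeasurableSpace (LocalRing L v) := borel _; haveI : BorelSpace (LocalRing L v) := ⟨rfl⟩
          haveI : SecondCountableTopology (LocalRing L v) := secondCountableTopology_localRing (E := L) v
          (skewModulus (conjLocal L (IsCMField.complexConj L) v) (continuous_conjLocal L (IsCMField.complexConj L) v) hb.unit
            (map_unit_torusScalar_sub_one_two (conjLocal L (IsCMField.complexConj L) v) (cmLocalForm_eq_over L 2 v)
              (⟨(t : ↥(unitaryGroupOfForm (conjLocal L (IsCMField.complexConj L) v) (cmLocalForm L 2 v))), t.2⟩ : ↥(torusU (conjLocal L (IsCMField.complexConj L) v) (cmLocalForm L 2 v))) hd hb)) : ℝ≥0) : ℝ) : ℂ) ≠ 0 := by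
    letI : MeasurableSpace (LocalRing L v) := borel _
    haveI : BorelSpace (LocalRing L v) := ⟨rfl⟩
    haveI : SecondCountableTopology (LocalRing L v) := secondCountableTopology_localRing (E := L) v
    exact_mod_cast (skewModulus_pos (conjLocal L (IsCMField.complexConj L) v) (continuous_conjLocal L (IsCMField.complexConj L) v) _ _).ne'
  simp only [measureReal_def, ENNReal.toReal_mul, ENNReal.toReal_div, ENNReal.coe_toReal]
  push_cast
  field_simp

end Literature.NumberTheory.Automorphic.UnitaryGroup

end
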